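import Literature.NumberTheory.EllipticCurves.Rank1Residual.Predicates
import Literature.NumberTheory.EllipticCurves.TateModuleTransvectionCriterionProofs
import HarnessLib

/-!
# BSD rank-≤1 residual cell — class X9 (residually small but irreducible image): (im) fails

HONEST FRAMING (cell `b2b-bsdres-*`, verbatim): the goal of the cell is to DELETE the
COMBINATION-SHAPED residual classes for ALL analytic-rank ≤ 1 curves over ℚ — "full BSD formula
for every rank ≤ 1 curve in class C" assembled STRICTLY from published theorems — so that the
rank-≤1 remainder becomes exactly the CONSTRUCTION-SHAPED classes, which are TYPED (missing-input
Props), NOT attempted; this is not "finishing BSD".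

Theorems only (no definitions, no named facts), over the cell's predicates
(`Rank1Residual/Predicates.lean`: `Irr`, `Surj`, `BigIm` = Burungale–Castella–Skinner's (im)
literally, `ClassX9`, `ClassX10`).  Class X9 = `¬cm ∧ ord(p) ∧ p ≥ 5 ∧ irr(p) ∧ ¬surj(p)`
(RESIDUAL-CASES.md §a.2; census instance `2268b1 @ 5`, image `5S4`) was labelled
COMBINATION-SHAPED on the strength of BCS, IMRN 2025, Cor. 1.3.1 (`p`-part of BSD in analytic rank
`≤ 1` at good ordinary `p > 3` under (irr_ℚ) + (im)), in the hope that (im) could be discharged by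
group theory on some exceptional image type (normaliser of a split / non-split Cartan subgroup,
projective image `𝔄₄`/`𝔖₄`/`𝔄₅`).

**Result (X9 prover, 2026-08-18): it cannot, on any type — (im) is FALSE on all of X9.**
`not_bigIm_of_irr_of_not_surj`: for ANY prime `p`, `irr(p) ∧ ¬surj(p) ⟹ ¬(im)`; so
`ClassX9.not_bigIm`, and the same at `p = 3` for the X9-shaped remainder X10b of class X10
(`ClassX10.not_bigIm_of_not_surj`, referee ruling R6.1).  Proof =
`WeierstrassCurve.not_exists_galoisRepTate_quotient_equiv` (`TateModuleTransvectionCriterionProofs`,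
p177495): a `σ ∈ G_{ℚ(μ_{p^∞})}` with `T_pE/(σ-1)T_pE ≅ ℤ_p` acts on `E[p]` by a transvection of
order `p` (`det = χ̄_p(σ) = 1`, cokernel of rank one mod `p`, Cayley–Hamilton), so `p ∣ #ρ̄(Γ_ℚ)`
and Serre 1972 Prop. 15 forces the image to be Borel (excluded by irr) or to contain `SL₂(𝔽_p)`,
hence to be everything (`det` onto) — excluded by ¬surj.  (Literature seat's remark F1 of
RESIDUAL-CASES (a-S) S1, now kernel-checked; independent machine checks of the finite group
theory: GAP over all subgroup classes of `GL₂(𝔽_p)`, `p ≤ 13`, and pure Python at pair level,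
`p ≤ 23` — cell folder `b2b-bsdres-x9/`.)

Consequence (where (im)/(sur) is USED, located in the primary texts): BCS arXiv:2405.00270v2
p. 10, proof of Thm. 1.1.2 — "(5.4) `(L_p(g/ℚ)) ⊂ ch_Λ(X_ord(g/ℚ_∞))` in `Λ` if hypothesis (im)
holds, and in `Λ ⊗ ℚ_p` otherwise" via [Kat04, Thm. 17.4], whose integral clause (3) is printed
under (12.5.2) "the image of `Gal(ℚ̄/ℚ(ζ_{p^∞})) → GL₂(O_λ)` contains `SL₂(ℤ_p)`" and, by
Skinner 2016 §2.5 (p. 11: "(a) `ρ̄_f` irreducible and (b) there exist `g ∈ Gal(ℚ̄/ℚ[μ_{p^∞}])`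
such that `T_f/(ρ_f(g)-1)T_f` is a free `O`-module of rank one"), under Kato's Thm. 13.4 (3)
hypothesis = (im); BCS p. 8, Thm. 4.2.1 (anticyclotomic side, rank 1): "if (sur) holds, then both
divisibilities hold integrally … [How04, Thm. B]" (Howard's `Gal(K̄/K) → Aut_{ℤ_p}(T)` surjective,
tree `HowardHypotheses.surjective`).  Every one of these hypotheses is UNSATISFIABLE on X9, so NO
class theorem `bsd_p_of_X9_<type>` can be assembled from BCS with (im) discharged; in print on X9
there remain BCS Thm. 1.1.2 (a) (equality in `Λ ⊗ ℚ_p`, tree fact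
`burungale_castella_skinner_charIdeal_eq_padicLFunction`), Kato 17.4 (2) and the per-curve
Heegner-index bounds (Cha 2005, Lawson–Wuthrich 2016), while Wuthrich 2014 Prop. 21 excludes
exactly these primes.  The class is therefore a TYPED residue (`Rank1Residual/Typed/X9.lean`:
missing input = the integral cyclotomic main conjecture at a prime with `p ∤ #ρ̄_{E,p}(Γ_ℚ)`,
announced for residually dihedral `p` in Burungale–Skinner [BS24], not out) — referee ruling R6.8:
not-deletable, recommended CONSTRUCTION-SHAPED.

## References

* [BurungaleCastellaSkinner2025] A. Burungale, F. Castella, C. Skinner, IMRN 2025 (rnaf082) =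
  arXiv:2405.00270v2: p. 2 (im), p. 3 (sur), Rem. 1.1.3 (iii), Rem. 1.2.3, p. 4 Cor. 1.3.1,
  p. 8 Thm. 4.2.1, p. 10 proof of Thm. 1.1.2.
* [Kato2004] K. Kato, Astérisque 295 (2004): Thm. 13.4 (v), (3); (12.5.2); Thm. 17.4 (2), (3).
* [Skinner2016PacificMC] C. Skinner, Pacific J. Math. 283 (2016), §2.5 (a), (b).
* [Howard2004HeegnerKolyvagin] B. Howard, Compositio Math. 140 (2004), Thm. B (hypotheses).
* [Serre1972] J.-P. Serre, Invent. Math. 15 (1972), §2.4 Prop. 15, §2.6.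
-/

noncomputable section

open scoped Classical

open WeierstrassCurve Field

namespace Literature.NumberTheory.EllipticCurves.Rank1Residual

variable (W : WeierstrassCurve ℚ) [W.IsElliptic] (p : ℕ) [Fact p.Prime]

/-- **irr(p) ∧ ¬surj(p) ⟹ ¬(im), for every prime `p`.**  If `E[p]` is irreducible and `ρ̄_{E,p}`
is not surjective, then Burungale–Castella–Skinner's hypothesis (im) (`BigIm`: some
`σ ∈ G_{ℚ(μ_{p^∞})}` with `T_pE/(σ-1)T_pE ≅ ℤ_p`) fails.  (Such a `σ` would act on `E[p]` by a
transvection of order `p`; Serre 1972, §2.4 Prop. 15.)  Kernel form of RESIDUAL-CASES (a-S) S1 F1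
"irr(p) ∧ (im) ⟹ surj(p)". [folklore] -/
theorem not_bigIm_of_irr_of_not_surj (hirr : Irr W p) (hns : ¬ Surj W p) : ¬ BigIm W p := by
  rintro ⟨σ, hσ, hequiv⟩
  refine W.not_exists_galoisRepTate_quotient_equiv p hirr hns ⟨σ, ?_, ?_⟩
  · intro n t ht
    rw [absoluteGaloisGroup.smul_def]
    exact hσ t n ht
  · simpa only [Module.End.one_eq_id] using hequiv

/-- **(irr) ∧ (im) ⟹ (sur)** — the contrapositive, as Burungale–Castella–Skinner's Rem. 1.1.3 (iii)
("under (irr_ℚ), the essential case excluded by Theorem 1.1.2 is that of (residually) dihedral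
primes") and the census's remark F1 use it: at a prime of irreducible mod-`p` image, (im) forces
`ρ̄_{E,p}` to be surjective. [folklore] -/
theorem surj_of_irr_of_bigIm (hirr : Irr W p) (him : BigIm W p) : Surj W p := by
  by_contra hns
  exact not_bigIm_of_irr_of_not_surj W p hirr hns him

/-- **Class X9 ⟹ ¬(im).**  On class X9 of the BSD rank-≤1 residual census (non-CM, good ordinary
`p ≥ 5`, `E[p]` irreducible, `ρ̄_{E,p}` not surjective) hypothesis (im) of BCS 2025 Thm. 1.1.2 (b)
/ Cor. 1.3.1 (= Kato 2004 Thm. 13.4 (3), Skinner 2016 §2.5 (b)) is violated by every Galois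
element — for every exceptional image type alike; no `bsd_p_of_X9_<type>` can be assembled from
these theorems.  Referee ruling R6.8 (cell b2b-bsdres): X9 not-deletable; recommended
CONSTRUCTION-SHAPED; typed residue in `Rank1Residual/Typed/X9.lean`. [folklore] -/
theorem ClassX9.not_bigIm [W.IsGloballyMinimal] (h : ClassX9 W p) : ¬ BigIm W p :=
  not_bigIm_of_irr_of_not_surj W p h.2.2.2.1 h.2.2.2.2.1

/-- **The X9-shaped remainder of class X10 (`p = 3`): ¬surj(3) ⟹ ¬(Im).**  For `ClassX10`
(`3` good ordinary, `E[3]` irreducible, off the printed floor) with `ρ̄_{E,3}` NOT surjective — the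
sub-class X10b ∋ `1210k1, 7442c1, 1690i1, 6050x1 @ 3` of referee ruling R6.1 — the hypothesis
(Im) of Yan–Zhu 2026 Thm. 4.15 (= BCS's (im) at `p = 3`) fails, so that theorem
(`YanZhu2026.thm415_padicValRat_bsd_rank_le_one`) has an unsatisfiable hypothesis there, exactly
as BCS on X9. [folklore] -/
theorem ClassX10.not_bigIm_of_not_surj [W.IsGloballyMinimal] (h : ClassX10 W p) (hns : ¬ Surj W 3) :
    ¬ BigIm W 3 :=
  not_bigIm_of_irr_of_not_surj W 3 h.2.2.1 hns

end Literature.NumberTheory.EllipticCurves.Rank1Residual
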